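import Summits.QuantumFields.YangMills.Theses.EntropyBudgetEquipartition
import Summits.QuantumFields.YangMills.Theorems.WeakCouplingRatesCurvatureCorrPowerFloor

/-!
# Route `EntropyBudgetEquipartition`, support item `FloorOfLocalLaw` (stmt-QuantumFields-22403): PROVED

`FloorOfLocalLaw`: for every compact simple `G` and lattice representation `r`, the TWO-SIDED local law
`|β²·Cov_{β,L}(cost₀, cost_n) − σ·C(n)²| ≤ C·β^(−κ)` (all `β ≥ β₀`, `1 ≤ n ≤ 2β^A`, eventually in the torus size `L`)
implies `∃ A' κ' > 0, PolySeparationPlaquetteFloor 4 r.ρ 1 2 A' κ'`.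

PROOF (real arithmetic, no gauge theory). Take the PROVED lattice-Maxwell floor
`WeakCouplingRates.curvatureCorrPowerFloor_proof`: `κ₀/n⁴ ≤ |C(n)|` for `n ≥ n₀`. Put `A' := min A (κ/16)` (so
`8A' ≤ κ/2 < κ`) and `κ' := σκ₀²/512`. At `T = ⌈β^{A'}⌉` (`1 ≤ T ≤ 2β^{A'} ≤ 2β^A` for `β ≥ 1`) the lower half
of the law gives `β²·Cov ≥ σ C(T)² − Cβ^{−κ} ≥ σκ₀²/(256 β^{8A'}) − Cβ^{−κ}`, and `Cβ^{−κ} ≤ σκ₀²/(512 β^{8A'})` as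
soon as `β^{−(κ−8A')} ≤ σκ₀²/(512 max(C,1))`, whence `Cov ≥ κ'·β^{−(2+8A')}`.

HONEST LABEL. Bookkeeping only: the two-sided law (item `EntropyBudgetTransfer`) is NOT proved here; the leaf this
route serves (`XiPow`) is an UPPER bound on the lattice gap (RECORD-label rung R2ξ-G), NOT the Clay mass gap.
-/

namespace Summit.QuantumFields.YangMills.Theorems

open Filter Topology
open Literature.MathematicalPhysics.QuantumFieldTheory Literature.MathematicalPhysics.QuantumLattice
open Summit.QuantumFields.YangMills.Theorems.WeakCouplingRates

/-- The real arithmetic of the floor extraction: from the lower half of the two-sided law at separation `T ≤ 2β^{A'}`,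
the curvature floor `κ₀/T⁴ ≤ |c|` and the smallness `β^{−(κ−8A')} ≤ σκ₀²/(512 C⁺)` one gets
`(σκ₀²/512)·β^{−(2+8A')} ≤ x`. -/
theorem floorOfLocalLaw_arith {β A' κ κ₀ σ C Cp T c x : ℝ} (hβ : 1 ≤ β) (hσ : 0 < σ) (hκ₀ : 0 < κ₀)
    (hT0 : 0 < T) (hT2 : T ≤ 2 * β ^ A') (hfloor : κ₀ / T ^ 4 ≤ |c|) (hC : C ≤ Cp) (hCp : 0 < Cp)
    (hsmall : β ^ (-(κ - 8 * A')) ≤ σ * κ₀ ^ 2 / (512 * Cp))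
    (hlaw : |β ^ 2 * x - σ * c ^ 2| ≤ C * β ^ (-κ)) :
    σ * κ₀ ^ 2 / 512 * β ^ (-(2 + 8 * A')) ≤ x := by
  have hβ0 : 0 < β := one_pos.trans_le hβ
  -- the lower half of the law
  have h1 : σ * c ^ 2 - C * β ^ (-κ) ≤ β ^ 2 * x := by
    have := (abs_le.1 hlaw).1
    linarith
  -- the floor at `T`, squared
  have hc2 : κ₀ ^ 2 / T ^ 8 ≤ c ^ 2 := by
    have hk0 : 0 ≤ κ₀ / T ^ 4 := by positivity
    have := mul_self_le_mul_self hk0 hfloor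
    rw [← sq, ← sq, sq_abs, div_pow] at this
    calc κ₀ ^ 2 / T ^ 8 = κ₀ ^ 2 / (T ^ 4) ^ 2 := by ring
      _ ≤ _ := this
  -- `T⁸ ≤ 256 (β^{A'})⁸`
  set P : ℝ := (β ^ A') ^ 8 with hPdef
  have hβA : 0 < β ^ A' := Real.rpow_pos_of_pos hβ0 A'
  have hP : 0 < P := by positivity
  have hT8 : T ^ 8 ≤ 256 * P := by
    have := pow_le_pow_left₀ hT0.le hT2 8
    calc T ^ 8 ≤ (2 * β ^ A') ^ 8 := this
      _ = 256 * P := by rw [hPdef]; ring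
  have hsig : σ * κ₀ ^ 2 / (256 * P) ≤ σ * c ^ 2 := by
    have h' : κ₀ ^ 2 / (256 * P) ≤ κ₀ ^ 2 / T ^ 8 :=
      div_le_div_of_nonneg_left (by positivity) (by positivity) hT8
    have := mul_le_mul_of_nonneg_left (h'.trans hc2) hσ.le
    calc σ * κ₀ ^ 2 / (256 * P) = σ * (κ₀ ^ 2 / (256 * P)) := by ring
      _ ≤ σ * c ^ 2 := this
  -- `β^{-8A'} = P⁻¹`, `β^{-κ} = β^{-(κ-8A')} · P⁻¹`, `β^{-(2+8A')} = (β² P)⁻¹`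
  have h8 : β ^ (-(8 * A')) = P⁻¹ := by
    rw [Real.rpow_neg hβ0.le, hPdef,
      show (8 : ℝ) * A' = A' * (8 : ℕ) by push_cast; ring, Real.rpow_mul_natCast hβ0.le]
  have hκsplit : β ^ (-κ) = β ^ (-(κ - 8 * A')) * P⁻¹ := by
    rw [← h8, ← Real.rpow_add hβ0]; ring_nf
  have h28 : β ^ (-(2 + 8 * A')) = (β ^ 2 * P)⁻¹ := by
    rw [Real.rpow_neg hβ0.le, Real.rpow_add hβ0, Real.rpow_two, hPdef,
      show (8 : ℝ) * A' = A' * (8 : ℕ) by push_cast; ring, Real.rpow_mul_natCast hβ0.le]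
  -- the error term is at most half the signal
  have herr : C * β ^ (-κ) ≤ σ * κ₀ ^ 2 / (512 * P) := by
    have hnn : 0 ≤ β ^ (-κ) := Real.rpow_nonneg hβ0.le _
    have e1 : C * β ^ (-κ) ≤ Cp * β ^ (-κ) := mul_le_mul_of_nonneg_right hC hnn
    have e2 : Cp * β ^ (-κ) = Cp * β ^ (-(κ - 8 * A')) * P⁻¹ := by rw [hκsplit]; ring
    have e3 : Cp * β ^ (-(κ - 8 * A')) ≤ σ * κ₀ ^ 2 / 512 := by
      have := mul_le_mul_of_nonneg_left hsmall hCp.le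
      calc Cp * β ^ (-(κ - 8 * A')) ≤ Cp * (σ * κ₀ ^ 2 / (512 * Cp)) := this
        _ = σ * κ₀ ^ 2 / 512 := by field_simp
    have e4 : Cp * β ^ (-(κ - 8 * A')) * P⁻¹ ≤ σ * κ₀ ^ 2 / 512 * P⁻¹ :=
      mul_le_mul_of_nonneg_right e3 (inv_nonneg.2 hP.le)
    calc C * β ^ (-κ) ≤ Cp * β ^ (-(κ - 8 * A')) * P⁻¹ := e2 ▸ e1
      _ ≤ σ * κ₀ ^ 2 / 512 * P⁻¹ := e4
      _ = σ * κ₀ ^ 2 / (512 * P) := by field_simp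
  -- assemble
  have key : σ * κ₀ ^ 2 / (512 * P) ≤ β ^ 2 * x := by
    have hid : σ * κ₀ ^ 2 / (256 * P) - σ * κ₀ ^ 2 / (512 * P) = σ * κ₀ ^ 2 / (512 * P) := by
      field_simp; ring
    linarith [hsig, herr, h1, hid]
  have hβ2 : 0 < β ^ 2 := by positivity
  rw [h28]
  have : σ * κ₀ ^ 2 / 512 * (β ^ 2 * P)⁻¹ = σ * κ₀ ^ 2 / (512 * P) / β ^ 2 := by
    field_simp
  rw [this, div_le_iff₀ hβ2]
  linarith [key]

/-- **Support item `FloorOfLocalLaw` of route `EntropyBudgetEquipartition`** (stmt-QuantumFields-22403): the two-sided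
free-gluon law of `EntropyBudgetTransfer`'s conclusion yields the one-scale power floor
`PolySeparationPlaquetteFloor 4 r.ρ 1 2 A' κ'` with `A' = min A (κ/16)`, `κ' = σκ₀²/512`, `κ₀` the constant of the
PROVED lattice-Maxwell curvature floor `WeakCouplingRates.curvatureCorrPowerFloor_proof`. -/
theorem floorOfLocalLaw_proof :
    Summit.QuantumFields.YangMills.Theses.EntropyBudgetEquipartition.FloorOfLocalLaw := by
  intro G _ _ _ _ hG
  letI : MeasurableSpace G := borel G
  haveI : BorelSpace G := ⟨rfl⟩
  intro r hlaw
  obtain ⟨κ, A, C, σ, β₀, hκ, hA, hσ, hlaw⟩ := hlaw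
  obtain ⟨κ₀, hκ₀, n₀, hF⟩ := curvatureCorrPowerFloor_proof
  -- exponents and constants
  set A' : ℝ := min A (κ / 16) with hA'def
  have hA' : 0 < A' := lt_min hA (by linarith)
  have hA'A : A' ≤ A := min_le_left _ _
  have hA'κ : A' ≤ κ / 16 := min_le_right _ _
  have hgap : 0 < κ - 8 * A' := by linarith
  set Cp : ℝ := max C 1 with hCpdef
  have hCp : 0 < Cp := lt_of_lt_of_le one_pos (le_max_right _ _)
  have hCCp : C ≤ Cp := le_max_left _ _
  refine ⟨A', σ * κ₀ ^ 2 / 512, hA', by positivity, ?_⟩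
  -- thresholds: `⌈β^{A'}⌉ ≥ n₀` and `β^{-(κ-8A')} ≤ σκ₀²/(512 C⁺)` eventually
  have hTinf : ∀ᶠ β : ℝ in atTop, (n₀ : ℝ) ≤ (⌈β ^ A'⌉₊ : ℝ) := by
    filter_upwards [(tendsto_rpow_atTop hA').eventually_ge_atTop (n₀ : ℝ)] with β hβ
    exact hβ.trans (Nat.le_ceil _)
  obtain ⟨β₃, hβ₃⟩ := eventually_atTop.1 hTinf
  have hsm : ∀ᶠ β : ℝ in atTop, β ^ (-(κ - 8 * A')) ≤ σ * κ₀ ^ 2 / (512 * Cp) := by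
    have ht : Tendsto (fun β : ℝ => β ^ (-(κ - 8 * A'))) atTop (𝓝 0) := tendsto_rpow_neg_atTop hgap
    exact ht.eventually (eventually_le_nhds (by positivity))
  obtain ⟨β₄, hβ₄⟩ := eventually_atTop.1 hsm
  refine ⟨max (max β₀ β₃) (max β₄ 1), fun β hβ => ?_⟩
  have hβ0' : β₀ ≤ β := (le_max_left _ _).trans ((le_max_left _ _).trans hβ)
  have hβ3 : β₃ ≤ β := (le_max_right _ _).trans ((le_max_left _ _).trans hβ)
  have hβ4 : β₄ ≤ β := (le_max_left _ _).trans ((le_max_right _ _).trans hβ)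
  have hβone : (1 : ℝ) ≤ β := (le_max_right _ _).trans ((le_max_right _ _).trans hβ)
  set T : ℕ := ⌈β ^ A'⌉₊ with hTdef
  obtain ⟨hT1, hT2⟩ := one_le_ceil_rpow_and_le (A := A') hβone hA'.le
  have hT0 : (0 : ℝ) < (T : ℝ) := one_pos.trans_le hT1
  have hT1nat : 1 ≤ T := by exact_mod_cast hT1
  have hTA : (T : ℝ) ≤ 2 * β ^ A := by
    have : β ^ A' ≤ β ^ A := Real.rpow_le_rpow_of_exponent_le hβone hA'A
    linarith
  have hn₀T : n₀ ≤ T := by exact_mod_cast hβ₃ β hβ3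
  have hfl := hF T hn₀T
  filter_upwards [hlaw β hβ0' T hT1nat hTA] with L hL
  exact floorOfLocalLaw_arith hβone hσ hκ₀ hT0 hT2 hfl hCCp hCp (hβ₄ β hβ4) hL

end Summit.QuantumFields.YangMills.Theorems
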